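import Literature.NumberTheory.Sieve.BalancedGenerators
import HarnessLib

/-!
# Balancing a positive real vector by a totally positive unit (Hinz 1988, p. 174 remark)

Topic `Literature/NumberTheory/Sieve`, sub-namespace `Balanced` (continues `BalancedGenerators`).
Hinz, p. 174: "If the `y_k` do not obey the inequalities (1.5) one can restore (1.5) by multiplying
the `y_k` by a suitably chosen totally positive unit of `K`". The tree's
`Balanced.exists_posUnit_log_le` balances the conjugates of a field element; here the same
fundamental-domain argument balances an ARBITRARY positive vector `(s_w)_w`:

* `exists_posUnit_log_le_vec` — `log |u|_w + log s_w ≤ (1/d) ∑_{w'} e_{w'} log s_{w'} + C` for a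
  totally positive unit `u`, `C = C(K)`;
* `exists_posUnit_mul_le_rpow` — exponentiated, for totally real `K`:
  `|u|_w s_w ≤ e^C (∏_{w'} s_{w'})^{1/d}`.

## References

* J. Hinz, Acta Arith. 51 (1988), §1 p. 174 (remark after (1.5)). [cite: Hinz1988, §1 (1.4)–(1.5)]
-/

noncomputable section

open NumberField NumberField.InfinitePlace NumberField.Units NumberField.Units.dirichletUnitTheorem
  Literature.NumberTheory.LFunctions Literature.NumberTheory.LFunctions.HeckeCone Finset
  Literature.NumberTheory.Sieve.NumberFieldLS
open scoped Classical

namespace Literature.NumberTheory.Sieve.Balanced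

variable (K : Type*) [Field K] [NumberField K]

local notation "d" => Module.finrank ℚ K

/-- **Balancing a positive vector** (see the file docstring). [cite: Hinz1988, §1 (1.4)–(1.5)] -/
theorem exists_posUnit_log_le_vec : ∃ C : ℝ, 0 ≤ C ∧ ∀ s : InfinitePlace K → ℝ, (∀ w, 0 < s w) →
    ∃ u : (𝓞 K)ˣ, u ∈ posUnits K ∧ ∀ w : InfinitePlace K,
      Real.log (w ((u : 𝓞 K) : K)) + Real.log (s w) ≤
        (∑ w' : InfinitePlace K, (mult w' : ℝ) * Real.log (s w')) / d + C := by
  -- the lattice `L⁺` and a bounded fundamental domain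
  let bL := Module.Free.chooseBasis ℤ (posUnitLattice K)
  let b := bL.ofZLatticeBasis ℝ (posUnitLattice K)
  obtain ⟨R, hR⟩ := (ZSpan.fundamentalDomain_isBounded b).subset_closedBall 0
  have hR0 : 0 ≤ R := by
    have h0 : (0 : logSpace K) ∈ ZSpan.fundamentalDomain b := by
      rw [ZSpan.mem_fundamentalDomain]; intro i; simp
    have := hR h0
    rwa [Metric.mem_closedBall, dist_zero_right, norm_zero] at this
  set n : ℕ := Fintype.card {w : InfinitePlace K // w ≠ w₀} with hn
  refine ⟨(n + 1) * R, by positivity, fun s hs => ?_⟩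
  -- the vector to be translated
  set N : ℝ := ∑ w' : InfinitePlace K, (mult w' : ℝ) * Real.log (s w') with hN
  set ℓ : ℝ := N / d with hℓ
  set v : logSpace K := fun w => (mult w.1 : ℝ) * (Real.log (s w.1) - ℓ) with hv
  set y : logSpace K := ZSpan.fract b (-v) with hy
  have hyR : ‖y‖ ≤ R := by
    have := hR (ZSpan.fract_mem_fundamentalDomain b (-v))
    rwa [Metric.mem_closedBall, dist_zero_right] at this
  have hmem : -v - y ∈ posUnitLattice K := by
    have h1 : -v - y = (ZSpan.floor b (-v) : logSpace K) := by
      rw [hy, ZSpan.fract_apply]; abel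
    have h2 : (ZSpan.floor b (-v) : logSpace K) ∈ Submodule.span ℤ (Set.range b) := (ZSpan.floor b (-v)).2
    have h3 : Submodule.span ℤ (Set.range b) = posUnitLattice K := bL.ofZLatticeBasis_span ℝ (posUnitLattice K)
    rw [h1]
    exact (SetLike.ext_iff.1 h3 _).1 h2
  obtain ⟨u, hu, hlog⟩ := exists_of_mem_posUnitLattice hmem
  refine ⟨u, hu, fun w => ?_⟩
  -- the quantity to balance
  set F : InfinitePlace K → ℝ := fun w => Real.log (w ((u : 𝓞 K) : K)) + Real.log (s w) with hF
  have hlogux : ∀ w : InfinitePlace K, F w = Real.log (w ((u : 𝓞 K) : K)) + Real.log (s w) := fun w => rfl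
  show F w ≤ N / d + (n + 1) * R
  -- the coordinates `w ≠ w₀`
  have hcoord : ∀ w' : {w : InfinitePlace K // w ≠ w₀},
      (mult w'.1 : ℝ) * (F w'.1 - ℓ) = -y w' := by
    intro w'
    have h1 := congr_fun hlog w'
    rw [logEmbedding_component] at h1
    have h2 : (-v - y) w' = -((mult w'.1 : ℝ) * (Real.log (s w'.1) - ℓ)) - y w' := by
      simp [hv]
    rw [h2] at h1
    rw [hlogux]
    linarith
  have hmult : ∀ w : InfinitePlace K, (1 : ℝ) ≤ mult w := fun w => by
    rw [mult]; split_ifs <;> norm_num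
  have hne : ∀ w' : {w : InfinitePlace K // w ≠ w₀},
      F w'.1 - ℓ ≤ R := by
    intro w'
    have h1 := hcoord w'
    have h2 : |y w'| ≤ R := (norm_le_pi_norm y w').trans hyR
    have h3 : |(mult w'.1 : ℝ) * (F w'.1 - ℓ)| ≤ R := by
      rw [h1, abs_neg]; exact h2
    rw [abs_mul, Nat.abs_cast] at h3
    have h4 : |F w'.1 - ℓ| ≤ R := by
      have hm := hmult w'.1
      have : |F w'.1 - ℓ| ≤
          (mult w'.1 : ℝ) * |F w'.1 - ℓ| :=
        le_mul_of_one_le_left (abs_nonneg _) hm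
      exact this.trans h3
    exact (le_abs_self _).trans h4
  -- the coordinate `w₀` through the product formula
  have hsum : ∑ w : InfinitePlace K, (mult w : ℝ) * (F w - ℓ) = 0 := by
    have h1 : ∑ w : InfinitePlace K, (mult w : ℝ) * F w = N := by
      simp_rw [hlogux, mul_add, Finset.sum_add_distrib]
      rw [sum_mult_mul_log u, zero_add]
    have h2 : ∑ w : InfinitePlace K, (mult w : ℝ) * ℓ = N := by
      rw [← Finset.sum_mul, hℓ]
      have : ∑ w : InfinitePlace K, (mult w : ℝ) = d := by exact_mod_cast sum_mult_eq (K := K)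
      rw [this, mul_div_cancel₀]
      exact_mod_cast Module.finrank_pos.ne'
    simp_rw [mul_sub, Finset.sum_sub_distrib, h1, h2, sub_self]
  have hw₀ : (mult (w₀ : InfinitePlace K) : ℝ) * (F w₀ - ℓ) =
      ∑ w' : {w : InfinitePlace K // w ≠ w₀}, y w' := by
    rw [Fintype.sum_eq_add_sum_subtype_ne _ w₀] at hsum
    simp_rw [hcoord] at hsum
    rw [Finset.sum_neg_distrib] at hsum
    linarith
  have hw₀le : F w₀ - ℓ ≤ n * R := by
    have h1 : |∑ w' : {w : InfinitePlace K // w ≠ w₀}, y w'| ≤ n * R := by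
      refine (Finset.abs_sum_le_sum_abs _ _).trans ?_
      calc ∑ w' : {w : InfinitePlace K // w ≠ w₀}, |y w'| ≤ ∑ _w' : {w : InfinitePlace K // w ≠ w₀}, R :=
            Finset.sum_le_sum fun w' _ => (norm_le_pi_norm y w').trans hyR
        _ = n * R := by rw [Finset.sum_const, Finset.card_univ, nsmul_eq_mul]
    rw [← hw₀, abs_mul, Nat.abs_cast] at h1
    have hm := hmult w₀
    have h2 : |F w₀ - ℓ| ≤ n * R :=
      (le_mul_of_one_le_left (abs_nonneg _) hm).trans h1
    exact (le_abs_self _).trans h2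
  -- conclusion
  by_cases hw : w = w₀
  · subst hw
    have : (n : ℝ) * R ≤ (n + 1) * R := by nlinarith
    linarith
  · have := hne ⟨w, hw⟩
    have : R ≤ (n + 1) * R := by nlinarith
    simp only at *
    linarith


/-- **Exponentiated, totally real case**: `|u|_w · s_w ≤ e^C (∏ s)^{1/d}`. [cite: Hinz1988, §1 (1.4)–(1.5)] -/
theorem exists_posUnit_mul_le_rpow [IsTotallyReal K] : ∃ C : ℝ, 1 ≤ C ∧ ∀ s : InfinitePlace K → ℝ, (∀ w, 0 < s w) →
    ∃ u : (𝓞 K)ˣ, u ∈ posUnits K ∧ ∀ w : InfinitePlace K,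
      w ((u : 𝓞 K) : K) * s w ≤ C * (∏ w', s w') ^ (1 / (d : ℝ)) := by
  obtain ⟨C, hC0, h⟩ := exists_posUnit_log_le_vec K
  refine ⟨Real.exp C, Real.one_le_exp hC0, fun s hs => ?_⟩
  obtain ⟨u, hu, hle⟩ := h s hs
  refine ⟨u, hu, fun w => ?_⟩
  have hu0 : 0 < w ((u : 𝓞 K) : K) := pos_iff.2 (by exact_mod_cast u.ne_zero)
  have hmult : ∀ w' : InfinitePlace K, (mult w' : ℝ) = 1 := fun w' => by
    rw [mult, if_pos (IsTotallyReal.isReal w')]; norm_num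
  have hsum : ∑ w' : InfinitePlace K, (mult w' : ℝ) * Real.log (s w') = Real.log (∏ w', s w') := by
    rw [Real.log_prod (s := Finset.univ) fun w' _ => (hs w').ne']
    exact Finset.sum_congr rfl fun w' _ => by rw [hmult, one_mul]
  have h1 := hle w
  rw [hsum] at h1
  have hprod : 0 < ∏ w', s w' := Finset.prod_pos fun w' _ => hs w'
  have h2 : Real.log (w ((u : 𝓞 K) : K) * s w) ≤ Real.log (Real.exp C * (∏ w', s w') ^ (1 / (d : ℝ))) := by
    rw [Real.log_mul hu0.ne' (hs w).ne', Real.log_mul (Real.exp_pos C).ne' (Real.rpow_pos_of_pos hprod _).ne',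
      Real.log_exp, Real.log_rpow hprod]
    have : (1 : ℝ) / d * Real.log (∏ w', s w') = Real.log (∏ w', s w') / d := by ring
    linarith
  exact (Real.log_le_log_iff (mul_pos hu0 (hs w)) (by positivity)).1 h2

end Literature.NumberTheory.Sieve.Balanced
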